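import Literature.NumberTheory.Rogawski1990.LocalNormFibreBlockDichotomyCM         -- ★ p841605 F0P3a-p08: `exists_conj_frame_or_of_isLocalNormPair`, `not_frame_and_frame_of_local`, `coe_endoGL_mul_swap`
import Literature.NumberTheory.Rogawski1990.LocalNormFibreNonsplit                 -- ★ p840359 F0P3a-p08: `isLocalStablyConjH_of_isLocalNormPair_of_finGammaTwo_eq`, `IsLocalNormPair.charpoly_eq`
import Literature.NumberTheory.Rogawski1990.FinExplicitTransferFactorStableInvariance -- ★ B-p10: `finGammaTwo_eq_of_isLocalStablyConjH`
import Literature.NumberTheory.Rogawski1990.LocalTransferCentralSingularJunctionCM  -- ★ p841395: `isUnit_eval_finCharpolyTwo_of_central`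
import Literature.NumberTheory.Automorphic.LocalEndoscopicOrbitClosed               -- ★ `isGRegular_of_isStablyConjH`
import HarnessLib

/-!
# The norm fibre at a `(G,H)`-regular singular pair, DOCK FORM: the binders `hside` ∕ `hdisj` of the invariant central singular junction from the block dichotomy
# (Rogawski 1990, §3.8 Prop. 3.8.1 (d); §8.1 proof of Prop. 8.1.3)

Topic `NumberTheory/Rogawski1990`; namespace `Literature.NumberTheory.Rogawski1990`.  THEOREMS ONLY (no definition, no instance, no notation, no named fact,
no `sorry`).  Cell `pub/hodgecm-mathlib` (D-0151), crux H413 = stmt-HodgeConjecture-24833, floor-2 line «N6nsGerm», stub `stub_N6nsS1`; the «B3-dock» adapter (LEAD F0P3a-plan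
(g9) T8-85 (3)) feeding the binders `hside`, `hdisj` of ★ `exists_nhds_stableOrbitalIntegralRel_eq_of_central_singular_inv` (`LocalTransferCentralSingularJunctionInvCM`,
F0P3a-p08) from ★ B3-alg (`LocalNormFibreBlockDichotomyCM`, p841605); seat F0P3a-p08 (g13).  HONEST LABEL: HC_CM is proved only modulo the printed citations until rung 0
closes; unconditional local algebra.

THE MATHEMATICS.  Central dock at the good class: `ε = y·ι(ε_H)·y⁻¹`, `θ : H_v ≃ₜ* Z_{G′_v}(ε)`, `θ z = y·ι(z)·y⁻¹`, `ε_H = (a·1₂, u)`, `u ≠ a`.  The DOCK FRAME of `ε` is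
`P := y·W` (`W` the coordinate swap `2 ↔ 3`, ★ `coe_endoGL_mul_swap`): `ε·(yW) = (yW)·(a·1₂ ⊕ᶠ u)` and, `ε` being unitary with `χ_{a·1}(u) = (u − a)²` a unit (★
`isUnit_eval_finCharpolyTwo_of_central`), its Gram matrix is block diagonal (★ `twistGram_eq_finSum_of_frame_unitary`) — `twistGram_dockFrame_eq_finSum`.  Given a frame `P′` of
the bad class (Gram blocks `G₁′ ⊕ᶠ G₂′`, rank-2 determinant class different from the dock frame's), ★ `exists_conj_frame_or_of_isLocalNormPair` puts every `γ′` matched with a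
`G`-regular `γ_H = (A, b)` either into `(yW)(B ⊕ᶠ b)(yW)⁻¹ = y·ι(B, b)·y⁻¹ = θ(B, b)` — and `(B, b) ~st γ_H` because both are matched with `γ′` and share `γ₂ = b` (★
`isLocalStablyConjH_of_isLocalNormPair_of_finGammaTwo_eq`) — or into the frame of `P′` with second block `b`: **`side_of_dock`** (= `hside`, for ALL `G`-regular `γ_H`, no
neighbourhood).  NEVER BOTH (**`disj_of_dock`** = `hdisj`): a realisation `x γ′ x⁻¹ = θ h` with `h ~st γ_H` is a realisation in the dock frame with blocks `(h.1, b)` (`γ₂(h) = b`, ★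
`finGammaTwo_eq_of_isLocalStablyConjH`) and `χ_{h.1}(b)`, `χ_{B′}(b) = χ_A(b)` are units, so ★ `not_frame_and_frame_of_local` applies.

## References
* [Rogawski1990] J. D. Rogawski, *Automorphic Representations of Unitary Groups in Three Variables*, Ann. of Math. Stud. 123 (1990): §3.8 Prop. 3.8.1 (d) p. 30; §4.8 p. 53; §8.1
  pp. 115–116.
-/

set_option autoImplicit false

noncomputable section

open NumberField IsDedekindDomain Matrix Polynomial Topology Filter
open scoped MatrixGroups

namespace Literature.NumberTheory.Rogawski1990

open Literature.NumberTheory.Automorphic Literature.NumberTheory.Automorphic.UnitaryGroup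
open Literature.AlgebraicGeometry.ShimuraVarieties (unitaryGroup)

section Dock

variable (L : Type) [Field L] [NumberField L] [IsCMField L] (H' : Matrix (Fin 3) (Fin 3) L) (v : HeightOneSpectrum (𝓞 ↥(maximalRealSubfield L)))

/-- `⊕ᶠ` is injective in the pair of blocks. [folklore] -/
private theorem finSum_inj₅ {S : Type*} [CommRing S] {N₁ N₂ : ℕ} {A C : Matrix (Fin N₁) (Fin N₁) S} {B D : Matrix (Fin N₂) (Fin N₂) S}
    (h : finSum N₁ N₂ A B = finSum N₁ N₂ C D) : A = C ∧ B = D := by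
  have h' := (Matrix.reindex finSumFinEquiv finSumFinEquiv).injective h
  rw [Matrix.fromBlocks_inj] at h'
  exact ⟨h'.1, h'.2.2.2⟩

/-- A `1 × 1` matrix is the scalar of its entry. [folklore] -/
private theorem fin_one_eq_smul_one₂ {S : Type*} [CommRing S] (C : Matrix (Fin 1) (Fin 1) S) : C = C 0 0 • (1 : Matrix (Fin 1) (Fin 1) S) := by
  ext i j
  obtain rfl : i = 0 := Subsingleton.elim _ _
  obtain rfl : j = 0 := Subsingleton.elim _ _
  simp

/-- The coordinate swap `2 ↔ 3` is an involution. [folklore] -/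
private theorem swap_mul_swap {S : Type*} [CommRing S] : !![(1 : S), 0, 0; 0, 0, 1; 0, 1, 0] * !![(1 : S), 0, 0; 0, 0, 1; 0, 1, 0] = 1 := by
  ext i j
  fin_cases i <;> fin_cases j <;> simp [Matrix.mul_apply, Fin.sum_univ_three]

/-- **`ι_v(h) = W (h.1 ⊕ᶠ h.2) W`** on the CM carriers (`W` the swap, `W⁻¹ = W`). [cite: Rogawski1990, §4.8 Case (a) p. 53] -/
theorem coe_endoEmbLocal_eq_swap_mul_finSum_mul_swap (h : ((cmDatum L 2 (Matrix.of fun i j : Fin 2 => if i.val + j.val + 1 = 2 then (1 : L) else 0)).Local v ×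
      (cmDatum L 1 (Matrix.of fun i j : Fin 1 => if i.val + j.val + 1 = 1 then (1 : L) else 0)).Local v)) :
    ((endoEmbLocal L v h).val.val : Matrix (Fin 3) (Fin 3) (LocalRing L v)) =
      !![(1 : LocalRing L v), 0, 0; 0, 0, 1; 0, 1, 0] * finSum 2 1 (h.1.val.val : Matrix (Fin 2) (Fin 2) (LocalRing L v)) (h.2.val.val : Matrix (Fin 1) (Fin 1) (LocalRing L v)) * !![(1 : LocalRing L v), 0, 0; 0, 0, 1; 0, 1, 0] := by
  have h1 : ((endoEmbLocal L v h).val.val : Matrix (Fin 3) (Fin 3) (LocalRing L v)) =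
      (endoGL ((h.1.val : GL (Fin 2) (LocalRing L v)), (h.2.val : GL (Fin 1) (LocalRing L v)))).val := rfl
  rw [h1, ← coe_endoGL_mul_swap, Matrix.mul_assoc, swap_mul_swap, Matrix.mul_one]

/-- **THE DOCK FRAME `y·W` OF `ε` HAS BLOCK-DIAGONAL GRAM MATRIX** (`ε (yW) = (yW)(a·1₂ ⊕ᶠ u)`, `ε` unitary, `(u − a)²` a unit).
[cite: Rogawski1990, §3.8 Prop. 3.8.1 (d) p. 30; §4.8 p. 53] -/
theorem twistGram_dockFrame_eq_finSum (w : PlacesOver L v) (hw : IsCMField.complexConj L • w.1 = w.1)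
    (εH : ((cmDatum L 2 (Matrix.of fun i j : Fin 2 => if i.val + j.val + 1 = 2 then (1 : L) else 0)).Local v ×
      (cmDatum L 1 (Matrix.of fun i j : Fin 1 => if i.val + j.val + 1 = 1 then (1 : L) else 0)).Local v)) (a : LocalRing L v)
    (ha : (εH.1.val.val : Matrix (Fin 2) (Fin 2) (LocalRing L v)) = a • (1 : Matrix (Fin 2) (Fin 2) (LocalRing L v)))
    (hu : (εH.2.val.val : Matrix (Fin 1) (Fin 1) (LocalRing L v)) 0 0 ≠ a)
    {ε : (cmDatum L 3 H').Local v} {y : GL (Fin 3) (LocalRing L v)} (hy : y * ((endoEmbLocal L v εH).val : GL (Fin 3) (LocalRing L v)) * y⁻¹ = ε.val)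
    {W : GL (Fin 3) (LocalRing L v)} (hW : W.val = !![(1 : LocalRing L v), 0, 0; 0, 0, 1; 0, 1, 0]) :
    ∃ (G₁ : Matrix (Fin 2) (Fin 2) (LocalRing L v)) (G₂ : Matrix (Fin 1) (Fin 1) (LocalRing L v)),
      twistGram (conjLocal L (IsCMField.complexConj L) v) ((adelicForm L 3 H').map (adeleToLocal L v)) (y * W).val = finSum 2 1 G₁ G₂ := by
  -- the frame equation `ε (yW) = (yW) (A_ε ⊕ᶠ u•1)`
  have hy' : y * endoGL ((εH.1.val : GL (Fin 2) (LocalRing L v)), (εH.2.val : GL (Fin 1) (LocalRing L v))) * y⁻¹ = ε.val := hy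
  have hb : finGammaTwo L v εH • (1 : Matrix (Fin 1) (Fin 1) (LocalRing L v)) = εH.2.val.val := (fin_one_eq_smul_one₂ _).symm
  have hframe : (ε.val.val : Matrix (Fin 3) (Fin 3) (LocalRing L v)) * (y * W).val =
      (y * W).val * finSum 2 1 (εH.1.val.val : Matrix (Fin 2) (Fin 2) (LocalRing L v)) (finGammaTwo L v εH • (1 : Matrix (Fin 1) (Fin 1) (LocalRing L v))) := by
    rw [hb, ← hy']
    simp only [Units.val_mul, hW, Matrix.mul_assoc]
    rw [← Matrix.mul_assoc (y⁻¹).val y.val, ← Units.val_mul, inv_mul_cancel, Units.val_one, Matrix.one_mul, coe_endoGL_mul_swap]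
  exact twistGram_eq_finSum_of_frame_unitary (N₁ := 2) (N₂ := 1) (conjLocal L (IsCMField.complexConj L) v) ((adelicForm L 3 H').map (adeleToLocal L v))
    (γ := (ε.val : GL (Fin 3) (LocalRing L v))) (Q := y * W) ε.2 hframe
    (conjLocal_finGammaTwo_mul_finGammaTwo L v εH) (isUnit_eval_finCharpolyTwo_of_central L v w hw εH a ha hu)

/-- A `θ`-image in the dock frame: `(θ h)·(yW) = (yW)·(h.1 ⊕ᶠ h.2)`. [cite: Rogawski1990, §4.8 Case (a) p. 53] -/
theorem coe_dock_mul_dockFrame {ε : (cmDatum L 3 H').Local v} {y : GL (Fin 3) (LocalRing L v)}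
    (θ : ((cmDatum L 2 (Matrix.of fun i j : Fin 2 => if i.val + j.val + 1 = 2 then (1 : L) else 0)).Local v ×
      (cmDatum L 1 (Matrix.of fun i j : Fin 1 => if i.val + j.val + 1 = 1 then (1 : L) else 0)).Local v) ≃ₜ* ↥(Subgroup.centralizer ({ε} : Set ((cmDatum L 3 H').Local v))))
    (hθ : ∀ z : ((cmDatum L 2 (Matrix.of fun i j : Fin 2 => if i.val + j.val + 1 = 2 then (1 : L) else 0)).Local v ×
      (cmDatum L 1 (Matrix.of fun i j : Fin 1 => if i.val + j.val + 1 = 1 then (1 : L) else 0)).Local v), (((θ z).1).val : GL (Fin 3) (LocalRing L v)) = y * ((endoEmbLocal L v z).val : GL (Fin 3) (LocalRing L v)) * y⁻¹)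
    {W : GL (Fin 3) (LocalRing L v)} (hW : W.val = !![(1 : LocalRing L v), 0, 0; 0, 0, 1; 0, 1, 0]) (h : ((cmDatum L 2 (Matrix.of fun i j : Fin 2 => if i.val + j.val + 1 = 2 then (1 : L) else 0)).Local v ×
      (cmDatum L 1 (Matrix.of fun i j : Fin 1 => if i.val + j.val + 1 = 1 then (1 : L) else 0)).Local v)) :
    (((((θ h : ↥(Subgroup.centralizer ({ε} : Set ((cmDatum L 3 H').Local v)))) : (cmDatum L 3 H').Local v)).val.val : Matrix (Fin 3) (Fin 3) (LocalRing L v))) * (y * W).val =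
      (y * W).val * finSum 2 1 (h.1.val.val : Matrix (Fin 2) (Fin 2) (LocalRing L v)) (h.2.val.val : Matrix (Fin 1) (Fin 1) (LocalRing L v)) := by
  have h1 : ((((θ h : ↥(Subgroup.centralizer ({ε} : Set ((cmDatum L 3 H').Local v)))) : (cmDatum L 3 H').Local v)).val.val : Matrix (Fin 3) (Fin 3) (LocalRing L v)) = y.val * (endoEmbLocal L v h).val.val * (y⁻¹).val := by
    rw [← Units.val_mul, ← Units.val_mul, ← hθ h]
  rw [h1, coe_endoEmbLocal_eq_swap_mul_finSum_mul_swap, Units.val_mul, hW]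
  simp only [Matrix.mul_assoc]
  rw [← Matrix.mul_assoc (y⁻¹).val y.val, ← Units.val_mul, inv_mul_cancel, Units.val_one, Matrix.one_mul, swap_mul_swap, Matrix.mul_one]

/-- **`hside` OF THE INVARIANT JUNCTION, from the dock** (for EVERY `G`-regular `γ_H`, no neighbourhood): a `γ′` matched with `γ_H` is `G′_v`-conjugate to some `θ h` with
`h ~st γ_H` (the good side), or to an element in the frame of `P′` with second block `γ₂(γ_H)` (the bad side). [cite: Rogawski1990, §3.8 Prop. 3.8.1 (d) p. 30; §8.1 pp. 115–116] -/
theorem side_of_dock (w : PlacesOver L v) (hw : IsCMField.complexConj L • w.1 = w.1) (hH' : (H'.map (cmConjRingHom L))ᵀ = H') (hdet' : H'.det ≠ 0)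
    (εH : ((cmDatum L 2 (Matrix.of fun i j : Fin 2 => if i.val + j.val + 1 = 2 then (1 : L) else 0)).Local v ×
      (cmDatum L 1 (Matrix.of fun i j : Fin 1 => if i.val + j.val + 1 = 1 then (1 : L) else 0)).Local v)) (a : LocalRing L v)
    (ha : (εH.1.val.val : Matrix (Fin 2) (Fin 2) (LocalRing L v)) = a • (1 : Matrix (Fin 2) (Fin 2) (LocalRing L v)))
    {ε : (cmDatum L 3 H').Local v} {y : GL (Fin 3) (LocalRing L v)}
    (θ : ((cmDatum L 2 (Matrix.of fun i j : Fin 2 => if i.val + j.val + 1 = 2 then (1 : L) else 0)).Local v ×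
      (cmDatum L 1 (Matrix.of fun i j : Fin 1 => if i.val + j.val + 1 = 1 then (1 : L) else 0)).Local v) ≃ₜ* ↥(Subgroup.centralizer ({ε} : Set ((cmDatum L 3 H').Local v))))
    (hθ : ∀ z : ((cmDatum L 2 (Matrix.of fun i j : Fin 2 => if i.val + j.val + 1 = 2 then (1 : L) else 0)).Local v ×
      (cmDatum L 1 (Matrix.of fun i j : Fin 1 => if i.val + j.val + 1 = 1 then (1 : L) else 0)).Local v), (((θ z).1).val : GL (Fin 3) (LocalRing L v)) = y * ((endoEmbLocal L v z).val : GL (Fin 3) (LocalRing L v)) * y⁻¹)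
    {W : GL (Fin 3) (LocalRing L v)} (hW : W.val = !![(1 : LocalRing L v), 0, 0; 0, 0, 1; 0, 1, 0])
    (hy : y * ((endoEmbLocal L v εH).val : GL (Fin 3) (LocalRing L v)) * y⁻¹ = ε.val)
    {G₁ G₁' : Matrix (Fin 2) (Fin 2) (LocalRing L v)} {G₂ G₂' : Matrix (Fin 1) (Fin 1) (LocalRing L v)} {P' : GL (Fin (2 + 1)) (LocalRing L v)}
    (hPW : twistGram (conjLocal L (IsCMField.complexConj L) v) ((adelicForm L 3 H').map (adeleToLocal L v)) (y * W).val = finSum 2 1 G₁ G₂)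
    (hP' : twistGram (conjLocal L (IsCMField.complexConj L) v) ((adelicForm L 3 H').map (adeleToLocal L v)) P'.val = finSum 2 1 G₁' G₂')
    (hnn : ¬ ∃ z : LocalRing L v, IsUnit z ∧ G₁'.det = G₁.det * (conjLocal L (IsCMField.complexConj L) v z * z))
    (γH : ((cmDatum L 2 (Matrix.of fun i j : Fin 2 => if i.val + j.val + 1 = 2 then (1 : L) else 0)).Local v ×
      (cmDatum L 1 (Matrix.of fun i j : Fin 1 => if i.val + j.val + 1 = 1 then (1 : L) else 0)).Local v)) (hreg : IsLocalGRegular L v γH) (γ' : (cmDatum L 3 H').Local v) (hm : IsLocalNormPair L H' v γH γ') :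
    (∃ x : (cmDatum L 3 H').Local v, ∃ h : ((cmDatum L 2 (Matrix.of fun i j : Fin 2 => if i.val + j.val + 1 = 2 then (1 : L) else 0)).Local v ×
      (cmDatum L 1 (Matrix.of fun i j : Fin 1 => if i.val + j.val + 1 = 1 then (1 : L) else 0)).Local v), IsLocalStablyConjH L v γH h ∧ x * γ' * x⁻¹ = ((θ h : ↥(Subgroup.centralizer ({ε} : Set ((cmDatum L 3 H').Local v)))) : (cmDatum L 3 H').Local v)) ∨
      (∃ x : (cmDatum L 3 H').Local v, ∃ B : Matrix (Fin 2) (Fin 2) (LocalRing L v),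
        ((x * γ' * x⁻¹).val.val : Matrix (Fin 3) (Fin 3) (LocalRing L v)) * P'.val = P'.val * finSum 2 1 B (γH.2.val.val : Matrix (Fin 1) (Fin 1) (LocalRing L v))) := by
  rcases exists_conj_frame_or_of_isLocalNormPair L H' v w hw hH' hdet' hPW hP' hnn hreg hm with ⟨x, B, hxB⟩ | hright
  · left
    -- `m := x γ′ x⁻¹ = (yW)(B ⊕ᶠ b)(yW)⁻¹` commutes with `ε = (yW)(a•1 ⊕ᶠ u•1)(yW)⁻¹`
    set m : (cmDatum L 3 H').Local v := x * γ' * x⁻¹ with hmdef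
    have hbε : (εH.2.val.val : Matrix (Fin 1) (Fin 1) (LocalRing L v)) = finGammaTwo L v εH • (1 : Matrix (Fin 1) (Fin 1) (LocalRing L v)) :=
      fin_one_eq_smul_one₂ _
    have hbγ : (γH.2.val.val : Matrix (Fin 1) (Fin 1) (LocalRing L v)) = finGammaTwo L v γH • (1 : Matrix (Fin 1) (Fin 1) (LocalRing L v)) :=
      fin_one_eq_smul_one₂ _
    have hεf := coe_dock_mul_dockFrame L H' v θ hθ hW εH
    have hθε : (((θ εH : ↥(Subgroup.centralizer ({ε} : Set ((cmDatum L 3 H').Local v)))) : (cmDatum L 3 H').Local v)) = ε := by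
      apply Subtype.ext; apply Units.ext
      rw [hθ εH, hy]
    rw [hθε, ha, hbε] at hεf
    rw [hbγ] at hxB
    have hPi : (y * W).val * ((y * W)⁻¹).val = 1 := by rw [← Units.val_mul, mul_inv_cancel, Units.val_one]
    have hPi' : ((y * W)⁻¹).val * (y * W).val = 1 := by rw [← Units.val_mul, inv_mul_cancel, Units.val_one]
    have hcomm : m * ε = ε * m := by
      apply Subtype.ext; apply Units.ext
      change (m.val.val : Matrix (Fin 3) (Fin 3) (LocalRing L v)) * ε.val.val = ε.val.val * m.val.val
      have em : (m.val.val : Matrix (Fin 3) (Fin 3) (LocalRing L v)) = (y * W).val * finSum 2 1 B (finGammaTwo L v γH • (1 : Matrix (Fin 1) (Fin 1) (LocalRing L v))) * ((y * W)⁻¹).val := by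
        rw [← hxB, Matrix.mul_assoc, hPi, Matrix.mul_one]
      have eε : (ε.val.val : Matrix (Fin 3) (Fin 3) (LocalRing L v)) = (y * W).val * finSum 2 1 (a • (1 : Matrix (Fin 2) (Fin 2) (LocalRing L v))) (finGammaTwo L v εH • (1 : Matrix (Fin 1) (Fin 1) (LocalRing L v))) * ((y * W)⁻¹).val := by
        rw [← hεf, Matrix.mul_assoc, hPi, Matrix.mul_one]
      rw [em, eε]
      calc (y * W).val * finSum 2 1 B (finGammaTwo L v γH • (1 : Matrix (Fin 1) (Fin 1) (LocalRing L v))) * ((y * W)⁻¹).val *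
            ((y * W).val * finSum 2 1 (a • (1 : Matrix (Fin 2) (Fin 2) (LocalRing L v))) (finGammaTwo L v εH • (1 : Matrix (Fin 1) (Fin 1) (LocalRing L v))) * ((y * W)⁻¹).val)
          = (y * W).val * (finSum 2 1 B (finGammaTwo L v γH • (1 : Matrix (Fin 1) (Fin 1) (LocalRing L v))) * ((((y * W)⁻¹).val * (y * W).val) *
              finSum 2 1 (a • (1 : Matrix (Fin 2) (Fin 2) (LocalRing L v))) (finGammaTwo L v εH • (1 : Matrix (Fin 1) (Fin 1) (LocalRing L v))))) * ((y * W)⁻¹).val := by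
            simp only [Matrix.mul_assoc]
        _ = (y * W).val * (finSum 2 1 (a • (1 : Matrix (Fin 2) (Fin 2) (LocalRing L v))) (finGammaTwo L v εH • (1 : Matrix (Fin 1) (Fin 1) (LocalRing L v))) * ((((y * W)⁻¹).val * (y * W).val) *
              finSum 2 1 B (finGammaTwo L v γH • (1 : Matrix (Fin 1) (Fin 1) (LocalRing L v))))) * ((y * W)⁻¹).val := by
            rw [hPi', Matrix.one_mul, Matrix.one_mul, smul_one_eq_diagonal, ← smul_one_eq_diagonal, finSum_commute_finSum_smul_one]
        _ = _ := by simp only [Matrix.mul_assoc]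
    have hmem : m ∈ Subgroup.centralizer ({ε} : Set ((cmDatum L 3 H').Local v)) := by
      rw [Subgroup.mem_centralizer_singleton_iff]
      exact hcomm
    -- `h := θ⁻¹ m`
    set h : ((cmDatum L 2 (Matrix.of fun i j : Fin 2 => if i.val + j.val + 1 = 2 then (1 : L) else 0)).Local v ×
      (cmDatum L 1 (Matrix.of fun i j : Fin 1 => if i.val + j.val + 1 = 1 then (1 : L) else 0)).Local v) := θ.symm ⟨m, hmem⟩ with hhdef
    have hθh : (((θ h : ↥(Subgroup.centralizer ({ε} : Set ((cmDatum L 3 H').Local v)))) : (cmDatum L 3 H').Local v)) = m := by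
      rw [hhdef, ContinuousMulEquiv.apply_symm_apply]
    refine ⟨x, h, ?_, hθh.symm⟩
    -- `h` is matched with `γ′` too and shares `γ₂` with `γ_H`
    have hmh : IsLocalNormPair L H' v h m := isConj_iff.2 ⟨y, by rw [← hθh]; exact (hθ h).symm⟩
    have hmh' : IsLocalNormPair L H' v h γ' := by
      refine IsConj.trans hmh (isConj_iff.2 ⟨x.val⁻¹, ?_⟩)
      change x.val⁻¹ * (x.val * γ'.val * x.val⁻¹) * x.val⁻¹⁻¹ = γ'.val
      group
    -- blocks of `h`: `(θ h)(yW) = (yW)(h.1 ⊕ᶠ h.2)` against `m (yW) = (yW)(B ⊕ᶠ b)`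
    have hhf := coe_dock_mul_dockFrame L H' v θ hθ hW h
    rw [hθh] at hhf
    have hblk : finSum 2 1 (h.1.val.val : Matrix (Fin 2) (Fin 2) (LocalRing L v)) (h.2.val.val : Matrix (Fin 1) (Fin 1) (LocalRing L v)) =
        finSum 2 1 B (finGammaTwo L v γH • (1 : Matrix (Fin 1) (Fin 1) (LocalRing L v))) := by
      have e := hhf.symm.trans hxB
      have e2 := congrArg (fun M => ((y * W)⁻¹).val * M) e
      simpa only [← Matrix.mul_assoc, hPi', Matrix.one_mul] using e2
    obtain ⟨-, h2⟩ := finSum_inj₅ hblk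
    have hu2 : finGammaTwo L v γH = finGammaTwo L v h := by
      have e := congrArg (fun M : Matrix (Fin 1) (Fin 1) (LocalRing L v) => M 0 0) h2
      simp only [Matrix.smul_apply, Matrix.one_apply_eq, smul_eq_mul, mul_one] at e
      exact e.symm
    exact isLocalStablyConjH_of_isLocalNormPair_of_finGammaTwo_eq L H' v hreg hm hmh' hu2
  · right
    exact hright

/-- **`hdisj` OF THE INVARIANT JUNCTION, from the dock**: no `γ′` has a conjugate `θ h` with `h ~st γ_H` AND a conjugate in the frame of `P′` with second block `γ₂(γ_H)`
(`γ_H` `G`-regular). [cite: Rogawski1990, §3.8 Prop. 3.8.1 (d) p. 30; §8.1 pp. 115–116] -/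
theorem disj_of_dock {ε : (cmDatum L 3 H').Local v} {y : GL (Fin 3) (LocalRing L v)}
    (θ : ((cmDatum L 2 (Matrix.of fun i j : Fin 2 => if i.val + j.val + 1 = 2 then (1 : L) else 0)).Local v ×
      (cmDatum L 1 (Matrix.of fun i j : Fin 1 => if i.val + j.val + 1 = 1 then (1 : L) else 0)).Local v) ≃ₜ* ↥(Subgroup.centralizer ({ε} : Set ((cmDatum L 3 H').Local v))))
    (hθ : ∀ z : ((cmDatum L 2 (Matrix.of fun i j : Fin 2 => if i.val + j.val + 1 = 2 then (1 : L) else 0)).Local v ×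
      (cmDatum L 1 (Matrix.of fun i j : Fin 1 => if i.val + j.val + 1 = 1 then (1 : L) else 0)).Local v), (((θ z).1).val : GL (Fin 3) (LocalRing L v)) = y * ((endoEmbLocal L v z).val : GL (Fin 3) (LocalRing L v)) * y⁻¹)
    {W : GL (Fin 3) (LocalRing L v)} (hW : W.val = !![(1 : LocalRing L v), 0, 0; 0, 0, 1; 0, 1, 0])
    {G₁ G₁' : Matrix (Fin 2) (Fin 2) (LocalRing L v)} {G₂ G₂' : Matrix (Fin 1) (Fin 1) (LocalRing L v)} {P' : GL (Fin (2 + 1)) (LocalRing L v)}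
    (hPW : twistGram (conjLocal L (IsCMField.complexConj L) v) ((adelicForm L 3 H').map (adeleToLocal L v)) (y * W).val = finSum 2 1 G₁ G₂)
    (hP' : twistGram (conjLocal L (IsCMField.complexConj L) v) ((adelicForm L 3 H').map (adeleToLocal L v)) P'.val = finSum 2 1 G₁' G₂')
    (hnn : ¬ ∃ z : LocalRing L v, IsUnit z ∧ G₁'.det = G₁.det * (conjLocal L (IsCMField.complexConj L) v z * z))
    (γH : ((cmDatum L 2 (Matrix.of fun i j : Fin 2 => if i.val + j.val + 1 = 2 then (1 : L) else 0)).Local v ×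
      (cmDatum L 1 (Matrix.of fun i j : Fin 1 => if i.val + j.val + 1 = 1 then (1 : L) else 0)).Local v)) (hreg : IsLocalGRegular L v γH) (γ' : (cmDatum L 3 H').Local v)
    (hε : ∃ x : (cmDatum L 3 H').Local v, ∃ h : ((cmDatum L 2 (Matrix.of fun i j : Fin 2 => if i.val + j.val + 1 = 2 then (1 : L) else 0)).Local v ×
      (cmDatum L 1 (Matrix.of fun i j : Fin 1 => if i.val + j.val + 1 = 1 then (1 : L) else 0)).Local v), IsLocalStablyConjH L v γH h ∧ x * γ' * x⁻¹ = ((θ h : ↥(Subgroup.centralizer ({ε} : Set ((cmDatum L 3 H').Local v)))) : (cmDatum L 3 H').Local v))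
    (hε' : ∃ x : (cmDatum L 3 H').Local v, ∃ B : Matrix (Fin 2) (Fin 2) (LocalRing L v),
      ((x * γ' * x⁻¹).val.val : Matrix (Fin 3) (Fin 3) (LocalRing L v)) * P'.val = P'.val * finSum 2 1 B (γH.2.val.val : Matrix (Fin 1) (Fin 1) (LocalRing L v))) :
    False := by
  obtain ⟨x, h, hst, hx⟩ := hε
  obtain ⟨x', B', hx'⟩ := hε'
  have hbγ : (γH.2.val.val : Matrix (Fin 1) (Fin 1) (LocalRing L v)) = finGammaTwo L v γH • (1 : Matrix (Fin 1) (Fin 1) (LocalRing L v)) :=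
    fin_one_eq_smul_one₂ _
  -- the good realisation in the dock frame: blocks `(h.1, γ₂)`
  have hhf := coe_dock_mul_dockFrame L H' v θ hθ hW h
  rw [← hx] at hhf
  have hu2 : finGammaTwo L v h = finGammaTwo L v γH := finGammaTwo_eq_of_isLocalStablyConjH L v hst
  have hb2 : (h.2.val.val : Matrix (Fin 1) (Fin 1) (LocalRing L v)) = finGammaTwo L v γH • (1 : Matrix (Fin 1) (Fin 1) (LocalRing L v)) := by
    rw [fin_one_eq_smul_one₂ (h.2.val.val : Matrix (Fin 1) (Fin 1) (LocalRing L v)), ← hu2]; rfl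
  rw [hb2] at hhf
  rw [hbγ] at hx'
  -- the unit conditions: `χ_{h.1}(γ₂)` (h is `G`-regular) and `χ_{B′}(γ₂) = χ_A(γ₂)`
  have hregh : IsLocalGRegular L v h := isGRegular_of_isStablyConjH _ _ _ _ hst hreg
  have hχ : IsUnit ((h.1.val.val : Matrix (Fin 2) (Fin 2) (LocalRing L v)).charpoly.eval (finGammaTwo L v γH)) := by
    rw [← hu2]; exact isUnit_eval_finCharpolyTwo_of_isLocalGRegular L v h hregh
  -- matching: `γ′`'s characteristic polynomial in two ways
  have hm : IsLocalNormPair L H' v γH γ' := by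
    have h1 : IsLocalNormPair L H' v h (((θ h : ↥(Subgroup.centralizer ({ε} : Set ((cmDatum L 3 H').Local v)))) : (cmDatum L 3 H').Local v)) := isConj_iff.2 ⟨y, (hθ h).symm⟩
    have h2 : IsLocalNormPair L H' v h γ' := by
      refine IsConj.trans h1 (isConj_iff.2 ⟨x.val⁻¹, ?_⟩)
      rw [← hx]
      change x.val⁻¹ * (x.val * γ'.val * x.val⁻¹) * x.val⁻¹⁻¹ = γ'.val
      group
    exact (isLocalNormPair_iff_of_isLocalStablyConjH L v H' hst γ').1 h2
  have hχ' : IsUnit (B'.charpoly.eval (finGammaTwo L v γH)) := by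
    -- `charpoly (x′ γ′ x′⁻¹) = χ_{B′} · (X − γ₂) = χ_A · (X − γ₂)`
    have hP'i : P'.val * (P'⁻¹).val = 1 := by rw [← Units.val_mul, mul_inv_cancel, Units.val_one]
    have e1 : (((x' * γ' * x'⁻¹).val.val : Matrix (Fin 3) (Fin 3) (LocalRing L v))).charpoly = finCharpolyTwo L v γH * (X - C (finGammaTwo L v γH)) := by
      have hc : IsLocalNormPair L H' v γH (x' * γ' * x'⁻¹) := IsConj.trans hm (isConj_iff.2 ⟨x'.val, rfl⟩)
      exact hc.charpoly_eq
    have e2 : (((x' * γ' * x'⁻¹).val.val : Matrix (Fin 3) (Fin 3) (LocalRing L v))).charpoly =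
        (finSum 2 1 B' (finGammaTwo L v γH • (1 : Matrix (Fin 1) (Fin 1) (LocalRing L v)))).charpoly := by
      have e : ((x' * γ' * x'⁻¹).val.val : Matrix (Fin 3) (Fin 3) (LocalRing L v)) =
          P'.val * finSum 2 1 B' (finGammaTwo L v γH • (1 : Matrix (Fin 1) (Fin 1) (LocalRing L v))) * (P'⁻¹).val := by
        rw [← hx', Matrix.mul_assoc, hP'i, Matrix.mul_one]
      rw [e, Matrix.coe_units_inv, Matrix.charpoly_units_conj]
    have e3 : (finSum 2 1 B' (finGammaTwo L v γH • (1 : Matrix (Fin 1) (Fin 1) (LocalRing L v)))).charpoly = B'.charpoly * (X - C (finGammaTwo L v γH)) := by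
      rw [finSum, Matrix.charpoly_reindex, Matrix.charpoly_fromBlocks_zero₁₂, smul_one_eq_diagonal, Matrix.charpoly_diagonal, Fin.prod_univ_one]
    have e4 : B'.charpoly * (X - C (finGammaTwo L v γH)) = finCharpolyTwo L v γH * (X - C (finGammaTwo L v γH)) := by rw [← e3, ← e2, e1]
    have e5 : B'.charpoly = finCharpolyTwo L v γH := (monic_X_sub_C _).isRegular.right e4
    rw [e5]
    exact isUnit_eval_finCharpolyTwo_of_isLocalGRegular L v γH hreg
  exact not_frame_and_frame_of_local L H' v hPW hP' hnn (γ' := γ') (x := x) (x' := x') hhf hx' hχ hχ'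

end Dock

end Literature.NumberTheory.Rogawski1990

end
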